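import Literature.Computability.MetaComplexity.FpLinearSystemsProofs
import Mathlib.LinearAlgebra.Matrix.Rank
import Mathlib.InformationTheory.Hamming
import HarnessLib

/-!
# Splitting the checks of a bit-regular Tanner graph: an LDPC parity-check matrix with bounded row AND column
# weights whose code sits inside the code of the sample (Gallager 1963 ensemble, deterministic half)

In the tree's sample space `PickSpace m d n 2` (`Literature/Computability/MetaComplexity/FpLinearSystemsProofs.lean`:
`m` rows = bits, each with `d` picks among `n` columns = checks; over `𝔽₂` a pick is just a check) the matrix of a
sample has rows of weight `≤ d` but COLUMNS (check degrees) of unbounded weight. This file PROVES the elementary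
repair used to state Gallager's existence theorem with honest LDPC parameters: number the sockets `(i,k)` landing in
check `j` in a fixed order and cut them into consecutive groups of `b`; the SPLIT MATRIX `splitMatrix ω b` has one row
per (check, group), so

* every row has weight `≤ b` and every column has weight `≤ d` (`hammingNorm_splitMatrix_row_le`,
  `hammingNorm_splitMatrix_col_le`);
* the original check row is the sum of its group rows, hence the code of the split matrix is CONTAINED in the code
  of the sample: `splitMatrix ω b *ᵥ v = 0 → Σ_i v_i row_i(ω) = 0` (`combVec_eq_zero_of_splitMatrix_mulVec`) — so a
  lower bound on the weights of the sample's kernel words is inherited;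
* at most `(m d + (b-1) n)/b` rows are non-zero, so `rank (splitMatrix ω b) ≤ (m d + (b-1) n)/b`
  (`rank_splitMatrix_le`) and the code keeps dimension `≥ m − (m d + (b-1) n)/b`;
* finally any matrix is replaced by a FULL-RANK matrix on a subset of its rows with the same code
  (`exists_fullRank_rows`, linear algebra: a maximal independent set of rows), which keeps the weight bounds.

Splitting a check into several checks on disjoint parts of its neighbourhood is the standard degree-normalisation
of Tanner graphs (Richardson–Urbanke, *Modern Coding Theory*, §8.1: codes from `(l,r)`-regular bipartite graphs);
no probability here. All statements proved; no named facts.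
-/

namespace Literature.InformationTheory.Coding

open Finset Matrix Literature.Computability.MetaComplexity

section Split

variable {m d n : ℕ}

/-- The sockets `(i,k)` (bit `i`, pick `k`) whose pick lands in check `j`. [cite: RichardsonUrbanke2008, §8.1 (sockets of the `(l,r)`-regular ensemble)] -/
def socketsAt (ω : PickSpace m d n 2) (j : Fin n) : Finset (Fin m × Fin d) :=
  univ.filter fun x => (ω x).1 = j

/-- The rank of a socket among the sockets landing in the same check, in the order of `finProdFinEquiv`
(socket `(i,k) ↦ i·d + k`). [folklore] -/
def sockRank (ω : PickSpace m d n 2) (x : Fin m × Fin d) : ℕ :=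
  ((socketsAt ω (ω x).1).filter fun y => (finProdFinEquiv y : ℕ) < finProdFinEquiv x).card

/-- Membership in `socketsAt`. [folklore] -/
@[simp] private theorem mem_socketsAt {ω : PickSpace m d n 2} {j : Fin n} {x : Fin m × Fin d} :
    x ∈ socketsAt ω j ↔ (ω x).1 = j := by
  simp [socketsAt]

/-- A socket rank is below the total number of sockets `m d`. [folklore] -/
private theorem sockRank_lt (ω : PickSpace m d n 2) (x : Fin m × Fin d) : sockRank ω x < m * d + 1 := by
  have h1 : sockRank ω x ≤ (univ : Finset (Fin m × Fin d)).card :=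
    Finset.card_le_card (fun y _ => Finset.mem_univ y)
  rw [Finset.card_univ, Fintype.card_prod, Fintype.card_fin, Fintype.card_fin] at h1
  omega

/-- The rank of a socket is below the degree of its check. [folklore] -/
private theorem sockRank_lt_card (ω : PickSpace m d n 2) (x : Fin m × Fin d) :
    sockRank ω x < (socketsAt ω (ω x).1).card := by
  apply Finset.card_lt_card
  refine Finset.filter_ssubset.2 ⟨x, mem_socketsAt.2 rfl, lt_irrefl _⟩

/-- Socket ranks are strictly monotone in the socket number within one check. [folklore] -/
private theorem sockRank_lt_sockRank {ω : PickSpace m d n 2} {x y : Fin m × Fin d} (hxy : (ω x).1 = (ω y).1)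
    (hlt : (finProdFinEquiv x : ℕ) < finProdFinEquiv y) : sockRank ω x < sockRank ω y := by
  unfold sockRank
  rw [hxy]
  apply Finset.card_lt_card
  refine Finset.ssubset_iff_subset_ne.2 ⟨fun z hz => ?_, fun heq => ?_⟩
  · obtain ⟨hz1, hz2⟩ := Finset.mem_filter.1 hz
    exact Finset.mem_filter.2 ⟨hz1, lt_trans hz2 hlt⟩
  · have hx : x ∈ (socketsAt ω (ω y).1).filter fun z => (finProdFinEquiv z : ℕ) < finProdFinEquiv y :=
      Finset.mem_filter.2 ⟨mem_socketsAt.2 hxy, hlt⟩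
    rw [← heq] at hx
    exact lt_irrefl _ (Finset.mem_filter.1 hx).2

/-- Socket ranks are injective on the sockets of one check. [folklore] -/
private theorem sockRank_injOn (ω : PickSpace m d n 2) (j : Fin n) :
    Set.InjOn (sockRank ω) (socketsAt ω j : Set (Fin m × Fin d)) := by
  intro x hx y hy hr
  have hx' := mem_socketsAt.1 (Finset.mem_coe.1 hx)
  have hy' := mem_socketsAt.1 (Finset.mem_coe.1 hy)
  have hxy : (ω x).1 = (ω y).1 := by rw [hx', hy']
  rcases lt_trichotomy (finProdFinEquiv x : ℕ) (finProdFinEquiv y) with h | h | h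
  · exact absurd hr (sockRank_lt_sockRank hxy h).ne
  · exact finProdFinEquiv.injective (Fin.ext h)
  · exact absurd hr.symm (sockRank_lt_sockRank hxy.symm h).ne

/-- The group of a socket: its rank divided by the group size `b`, as an index below `m d + 1`. [folklore] -/
def grpFin (ω : PickSpace m d n 2) (b : ℕ) (x : Fin m × Fin d) : Fin (m * d + 1) :=
  ⟨sockRank ω x / b, lt_of_le_of_lt (Nat.div_le_self _ _) (sockRank_lt ω x)⟩

/-- **The split parity-check matrix** of a sample: one row per (check `j`, group `g`), whose entry at bit `i` is the
number (mod 2) of picks `k` of `i` landing in check `j` with socket group `g`. Rows = checks of degree `≤ b`,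
columns = bits of degree `≤ d`. (definition) [cite: RichardsonUrbanke2008, §8.1 (codes from regular bipartite graphs: a check is the parity of its socket neighbours)] -/
def splitMatrix (ω : PickSpace m d n 2) (b : ℕ) : Matrix (Fin n × Fin (m * d + 1)) (Fin m) (ZMod 2) :=
  fun r i => ∑ k : Fin d, if (ω (i, k)).1 = r.1 ∧ grpFin ω b (i, k) = r.2 then 1 else 0

/-- A non-zero entry of the split matrix comes from a socket of that bit in that (check, group). [folklore] -/
private theorem exists_socket_of_splitMatrix_ne_zero {ω : PickSpace m d n 2} {b : ℕ} {r : Fin n × Fin (m * d + 1)}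
    {i : Fin m} (h : splitMatrix ω b r i ≠ 0) : ∃ k : Fin d, (ω (i, k)).1 = r.1 ∧ grpFin ω b (i, k) = r.2 := by
  by_contra hne
  apply h
  refine Finset.sum_eq_zero fun k _ => ?_
  rw [if_neg]
  exact fun hk => hne ⟨k, hk.1, hk.2⟩

/-- **Row weights of the split matrix are at most the group size**: `wt(row (j,g)) ≤ b` (`0 < b`). The bits of row
`(j,g)` come from sockets of check `j` with rank in `[g b, g b + b)`, and ranks are injective on a check. [cite: RichardsonUrbanke2008, §8.1 (check degree `r` of the `(l,r)`-regular ensemble)] -/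
theorem hammingNorm_splitMatrix_row_le (ω : PickSpace m d n 2) {b : ℕ} (hb : 0 < b)
    (r : Fin n × Fin (m * d + 1)) : hammingNorm (splitMatrix ω b r) ≤ b := by
  classical
  -- the sockets of check `r.1` in group `r.2`
  set T : Finset (Fin m × Fin d) := (socketsAt ω r.1).filter fun x => grpFin ω b x = r.2 with hT
  have hTcard : T.card ≤ b := by
    have hinj : Set.InjOn (sockRank ω) (T : Set (Fin m × Fin d)) := fun x hx y hy hxy =>
      sockRank_injOn ω r.1 (Finset.mem_coe.2 (Finset.mem_filter.1 (Finset.mem_coe.1 hx)).1)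
        (Finset.mem_coe.2 (Finset.mem_filter.1 (Finset.mem_coe.1 hy)).1) hxy
    have hmaps : ∀ x ∈ T, sockRank ω x ∈ Finset.Ico ((r.2 : ℕ) * b) ((r.2 : ℕ) * b + b) := by
      intro x hx
      have hg : sockRank ω x / b = r.2 := by
        have := (Finset.mem_filter.1 hx).2
        exact congrArg Fin.val this
      rw [Finset.mem_Ico]
      constructor
      · rw [← hg]; exact Nat.div_mul_le_self _ _
      · rw [← hg]
        have := Nat.lt_div_mul_add (a := sockRank ω x) hb
        linarith [Nat.mul_comm (sockRank ω x / b) b]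
    calc T.card ≤ (Finset.Ico ((r.2 : ℕ) * b) ((r.2 : ℕ) * b + b)).card :=
          Finset.card_le_card_of_injOn _ hmaps hinj
      _ = b := by simp
  calc hammingNorm (splitMatrix ω b r) ≤ (T.image Prod.fst).card := by
        unfold hammingNorm
        refine Finset.card_le_card fun i hi => ?_
        obtain ⟨k, hk1, hk2⟩ := exists_socket_of_splitMatrix_ne_zero (Finset.mem_filter.1 hi).2
        exact Finset.mem_image.2 ⟨(i, k), Finset.mem_filter.2 ⟨mem_socketsAt.2 hk1, hk2⟩, rfl⟩
    _ ≤ T.card := Finset.card_image_le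
    _ ≤ b := hTcard

/-- **Column weights of the split matrix are at most the number of picks**: `wt(column i) ≤ d` (each pick of bit
`i` accounts for at most one (check, group)). [cite: RichardsonUrbanke2008, §8.1 (variable degree `l`)] -/
theorem hammingNorm_splitMatrix_col_le (ω : PickSpace m d n 2) (b : ℕ) (i : Fin m) :
    hammingNorm (fun r => splitMatrix ω b r i) ≤ d := by
  classical
  calc hammingNorm (fun r => splitMatrix ω b r i)
      ≤ ((univ : Finset (Fin d)).image fun k => ((ω (i, k)).1, grpFin ω b (i, k))).card := by
        unfold hammingNorm
        refine Finset.card_le_card fun r hr => ?_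
        obtain ⟨k, hk1, hk2⟩ := exists_socket_of_splitMatrix_ne_zero (Finset.mem_filter.1 hr).2
        exact Finset.mem_image.2 ⟨k, Finset.mem_univ _, Prod.ext hk1 hk2⟩
    _ ≤ (univ : Finset (Fin d)).card := Finset.card_image_le
    _ = d := by simp

/-- Over `𝔽₂` a pick's value is `1`. [folklore] -/
private theorem units_zmod_two_val (u : (ZMod 2)ˣ) : (u : ZMod 2) = 1 := by
  have h := u.ne_zero
  revert h
  generalize (u : ZMod 2) = x
  revert x
  decide

/-- A check row of the sample is the sum of its group rows: `row_i(ω)_j = Σ_g splitMatrix ω b (j,g) i`. [folklore] -/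
private theorem rowVec_eq_sum_splitMatrix (ω : PickSpace m d n 2) (b : ℕ) (i : Fin m) (j : Fin n) :
    rowVec ω i j = ∑ g : Fin (m * d + 1), splitMatrix ω b (j, g) i := by
  classical
  unfold rowVec splitMatrix
  rw [Finset.sum_comm]
  refine Finset.sum_congr rfl fun k _ => ?_
  by_cases h : (ω (i, k)).1 = j
  · simp only [h, true_and, units_zmod_two_val, if_true]
    rw [Finset.sum_ite_eq]
    simp
  · simp [h]

/-- **The split code lies inside the sample's code**: if `splitMatrix ω b v = 0` then every check of the sample
is satisfied, `Σ_i v_i row_i(ω)_j = 0` for all `j`. Hence every lower bound on the weight of the sample's non-zero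
kernel words holds for the split code. [cite: RichardsonUrbanke2008, Thm 8.2 (p. 428: the code of the graph)] -/
theorem combVec_eq_zero_of_splitMatrix_mulVec {ω : PickSpace m d n 2} {b : ℕ} {v : Fin m → ZMod 2}
    (h : splitMatrix ω b *ᵥ v = 0) (j : Fin n) : combVec ω v j = 0 := by
  classical
  unfold combVec
  calc ∑ i, v i * rowVec ω i j = ∑ i, v i * ∑ g : Fin (m * d + 1), splitMatrix ω b (j, g) i := by
        simp_rw [rowVec_eq_sum_splitMatrix ω b]
    _ = ∑ g : Fin (m * d + 1), (splitMatrix ω b *ᵥ v) (j, g) := by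
        simp only [Matrix.mulVec, dotProduct, Finset.mul_sum]
        rw [Finset.sum_comm]
        exact Finset.sum_congr rfl fun g _ => Finset.sum_congr rfl fun i _ => mul_comm _ _
    _ = 0 := by simp [h]

/-- The check degrees add up to the number of sockets: `Σ_j |socketsAt ω j| = m d`. [folklore] -/
private theorem sum_card_socketsAt (ω : PickSpace m d n 2) : ∑ j, (socketsAt ω j).card = m * d := by
  classical
  have := (Finset.card_eq_sum_card_fiberwise (s := (univ : Finset (Fin m × Fin d))) (t := (univ : Finset (Fin n)))
    (f := fun x => (ω x).1) fun x _ => Finset.mem_univ _).symm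
  simp only [Finset.card_univ, Fintype.card_prod, Fintype.card_fin] at this
  rw [← this]
  rfl

/-- A non-zero row `(j,g)` of the split matrix has `g b < deg j`. [folklore] -/
private theorem mul_lt_card_of_splitMatrix_row_ne_zero {ω : PickSpace m d n 2} {b : ℕ} {r : Fin n × Fin (m * d + 1)}
    (h : splitMatrix ω b r ≠ 0) : (r.2 : ℕ) * b < (socketsAt ω r.1).card := by
  obtain ⟨i, hi⟩ := Function.ne_iff.1 h
  obtain ⟨k, hk1, hk2⟩ := exists_socket_of_splitMatrix_ne_zero hi
  have hg : sockRank ω (i, k) / b = r.2 := congrArg Fin.val hk2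
  have hlt := sockRank_lt_card ω (i, k)
  rw [hk1] at hlt
  calc (r.2 : ℕ) * b = sockRank ω (i, k) / b * b := by rw [hg]
    _ ≤ sockRank ω (i, k) := Nat.div_mul_le_self _ _
    _ < _ := hlt

/-- Sum of integer quotients is at most the quotient of the sum. [folklore] -/
private theorem sum_div_le_sum_div {ι : Type*} (s : Finset ι) (f : ι → ℕ) (b : ℕ) :
    ∑ x ∈ s, f x / b ≤ (∑ x ∈ s, f x) / b := by
  rcases Nat.eq_zero_or_pos b with rfl | hb
  · simp
  rw [Nat.le_div_iff_mul_le hb, Finset.sum_mul]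
  exact Finset.sum_le_sum fun x _ => Nat.div_mul_le_self _ _

/-- **Few non-zero rows**: the split matrix has at most `(m d + (b-1) n)/b` non-zero rows (check `j` contributes
`⌈deg j / b⌉` and the degrees sum to `m d`). [folklore] -/
private theorem card_splitMatrix_row_ne_zero_le (ω : PickSpace m d n 2) {b : ℕ} (hb : 0 < b) :
    (univ.filter fun r => splitMatrix ω b r ≠ 0).card ≤ (m * d + (b - 1) * n) / b := by
  classical
  -- non-zero rows inject into the pairs `(j, g)` with `g < ⌈deg j / b⌉`
  set U : Finset (Fin n × ℕ) := (univ : Finset (Fin n)).sigma (fun j => Finset.range (((socketsAt ω j).card + (b - 1)) / b))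
    |>.map ⟨fun x => (x.1, x.2), fun x y h => by
      cases x; cases y; simp only [Prod.mk.injEq] at h; cases h.1; cases h.2; rfl⟩ with hU
  have hsub : ∀ r ∈ univ.filter (fun r => splitMatrix ω b r ≠ 0), (r.1, (r.2 : ℕ)) ∈ U := by
    intro r hr
    have h := mul_lt_card_of_splitMatrix_row_ne_zero (Finset.mem_filter.1 hr).2
    rw [hU, Finset.mem_map]
    refine ⟨⟨r.1, r.2⟩, Finset.mem_sigma.2 ⟨Finset.mem_univ _, Finset.mem_range.2 ?_⟩, rfl⟩
    change (r.2 : ℕ) < ((socketsAt ω r.1).card + (b - 1)) / b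
    have h' : (r.2 : ℕ) + 1 ≤ ((socketsAt ω r.1).card + (b - 1)) / b := by
      rw [Nat.le_div_iff_mul_le hb, Nat.add_mul, one_mul]
      omega
    omega
  have hinj : Set.InjOn (fun r : Fin n × Fin (m * d + 1) => (r.1, (r.2 : ℕ)))
      (univ.filter fun r => splitMatrix ω b r ≠ 0 : Set _) := by
    intro x _ y _ h
    simp only [Prod.mk.injEq] at h
    exact Prod.ext h.1 (Fin.ext h.2)
  calc (univ.filter fun r => splitMatrix ω b r ≠ 0).card ≤ U.card := Finset.card_le_card_of_injOn _ hsub hinj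
    _ = ∑ j, (((socketsAt ω j).card + (b - 1)) / b) := by
        rw [hU, Finset.card_map, Finset.card_sigma]
        simp
    _ ≤ (∑ j, ((socketsAt ω j).card + (b - 1))) / b := sum_div_le_sum_div _ _ _
    _ = (m * d + (b - 1) * n) / b := by
        rw [Finset.sum_add_distrib, sum_card_socketsAt, Finset.sum_const, Finset.card_univ, Fintype.card_fin,
          smul_eq_mul, mul_comm n]

/-- The rank of a matrix is at most its number of non-zero rows. [folklore] -/
private theorem rank_le_card_row_ne_zero {R C : Type*} [Fintype R] [Fintype C] [DecidableEq C] {K : Type*} [Field K]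
    [DecidableEq K] (M : Matrix R C K) : M.rank ≤ (univ.filter fun r => M r ≠ 0).card := by
  classical
  rw [Matrix.rank_eq_finrank_span_row]
  set S := univ.filter fun r => M r ≠ 0 with hS
  have hle : Submodule.span K (Set.range M) ≤ Submodule.span K ((S.image M : Finset (C → K)) : Set (C → K)) := by
    refine Submodule.span_le.2 ?_
    rintro _ ⟨r, rfl⟩
    by_cases h : M r = 0
    · rw [h]; exact Submodule.zero_mem _
    · exact Submodule.subset_span (Finset.mem_coe.2 (Finset.mem_image.2 ⟨r, Finset.mem_filter.2 ⟨Finset.mem_univ _, h⟩, rfl⟩))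
  calc Module.finrank K (Submodule.span K (Set.range M))
      ≤ Module.finrank K (Submodule.span K ((S.image M : Finset (C → K)) : Set (C → K))) :=
        Submodule.finrank_mono hle
    _ ≤ (S.image M).card := finrank_span_finset_le_card _
    _ ≤ S.card := Finset.card_image_le

/-- **Rank bound for the split matrix**: `rank (splitMatrix ω b) ≤ (m d + (b-1) n)/b`, so the split code has
dimension `≥ m − (m d + (b-1) n)/b`. [cite: RichardsonUrbanke2008, §8.1 (design rate `1 − l/r` of the `(l,r)`-regular ensemble)] -/
theorem rank_splitMatrix_le (ω : PickSpace m d n 2) {b : ℕ} (hb : 0 < b) :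
    (splitMatrix ω b).rank ≤ (m * d + (b - 1) * n) / b :=
  (rank_le_card_row_ne_zero _).trans (card_splitMatrix_row_ne_zero_le ω hb)

end Split

/-! ### Full-rank row selection -/

section FullRank

variable {K : Type*} [Field K] {R C : Type*} [Fintype R] [Fintype C]

/-- **Full-rank row selection.** Every matrix `M` has a set of `rank M` rows which are linearly independent and
span the row space; re-indexed by `Fin (rank M)` they form a full-rank matrix `M.submatrix e id` with the SAME
code (`ker`) as `M`. (A maximal linearly independent subfamily of the rows; this is the normalisation "let `H` be a
full-rank parity-check matrix" of Tillich–Zémor's Theorem 1.) [cite: TillichZemor2014, Thm 1 hypothesis (arXiv:0903.0566v1 chunk p0003 L71-80: "full-rank `(n-k)×n` parity-check matrix")] -/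
theorem exists_fullRank_rows (M : Matrix R C K) :
    ∃ e : Fin M.rank → R, Function.Injective e ∧ (M.submatrix e id).rank = M.rank ∧
      ∀ v : C → K, (M.submatrix e id) *ᵥ v = 0 ↔ M *ᵥ v = 0 := by
  classical
  obtain ⟨κ, a, ha, hspan, hli⟩ := exists_linearIndependent' K (fun r : R => M r)
  haveI : Fintype κ := Fintype.ofInjective a ha
  -- `κ` has `rank M` elements
  have hcard : Fintype.card κ = M.rank := by
    rw [Matrix.rank_eq_finrank_span_row]
    change Fintype.card κ = Module.finrank K (Submodule.span K (Set.range fun r => M r))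
    rw [← hspan, finrank_span_eq_card hli]
  let e : Fin M.rank → R := a ∘ (Fintype.equivFinOfCardEq hcard).symm
  have he : Function.Injective e := ha.comp (Fintype.equivFinOfCardEq hcard).symm.injective
  have hrange : Set.range (fun r => M r) ⊆ (Submodule.span K (Set.range ((fun r => M r) ∘ a)) : Set (C → K)) := by
    rw [hspan]; exact Submodule.subset_span
  -- same kernel
  have hker : ∀ v : C → K, (M.submatrix e id) *ᵥ v = 0 ↔ M *ᵥ v = 0 := by
    intro v
    constructor
    · intro h
      -- every row of `M` is a combination of the selected rows, which all kill `v`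
      have hsel : ∀ x : κ, M (a x) ⬝ᵥ v = 0 := by
        intro x
        have := congrFun h ((Fintype.equivFinOfCardEq hcard) x)
        simpa [Matrix.mulVec, e] using this
      funext r
      have hr : M r ∈ Submodule.span K (Set.range ((fun r => M r) ∘ a)) := hrange ⟨r, rfl⟩
      rw [Matrix.mulVec, Pi.zero_apply]
      refine Submodule.span_induction (p := fun w _ => w ⬝ᵥ v = 0) ?_ ?_ ?_ ?_ hr
      · rintro _ ⟨x, rfl⟩; exact hsel x
      · exact zero_dotProduct v
      · intro x y _ _ hx hy; rw [add_dotProduct, hx, hy, add_zero]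
      · intro c x _ hx; rw [smul_dotProduct, hx, smul_zero]
    · intro h
      funext x
      have := congrFun h (e x)
      simpa [Matrix.mulVec] using this
  refine ⟨e, he, ?_, hker⟩
  -- rank of the selection = number of rows (they are linearly independent)
  rw [Matrix.rank_eq_finrank_span_row]
  have hli' : LinearIndependent K (fun x : Fin M.rank => (M.submatrix e id) x) := by
    have : (fun x : Fin M.rank => (M.submatrix e id) x) = ((fun r => M r) ∘ a) ∘ (Fintype.equivFinOfCardEq hcard).symm := by
      funext x; rfl
    rw [this]
    exact hli.comp _ (Fintype.equivFinOfCardEq hcard).symm.injective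
  change Module.finrank K (Submodule.span K (Set.range fun x => (M.submatrix e id) x)) = M.rank
  rw [finrank_span_eq_card hli', Fintype.card_fin]

omit [Fintype R] in
/-- Rows of a row-selection are rows of the original, so row weights do not increase. [cite: TillichZemor2014, §4 (arXiv:0903.0566v1 chunk p0007 L25-45: row and column weights of the parity-check matrices)] -/
theorem hammingNorm_submatrix_row [DecidableEq K] {ι : Type*} (M : Matrix R C K) (e : ι → R) (x : ι) :
    hammingNorm ((M.submatrix e id) x) = hammingNorm (M (e x)) := rfl

omit [Fintype C] in
/-- Column weights of an injective row-selection do not exceed those of the original. [cite: TillichZemor2014, §4 (arXiv:0903.0566v1 chunk p0007 L25-45: row and column weights of the parity-check matrices)] -/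
theorem hammingNorm_submatrix_col_le [DecidableEq K] {ι : Type*} [Fintype ι] (M : Matrix R C K) {e : ι → R}
    (he : Function.Injective e) (j : C) :
    hammingNorm (fun x => (M.submatrix e id) x j) ≤ hammingNorm (fun r => M r j) := by
  classical
  unfold hammingNorm
  calc (univ.filter fun x => (M.submatrix e id) x j ≠ 0).card
      = ((univ.filter fun x => (M.submatrix e id) x j ≠ 0).image e).card := (Finset.card_image_of_injective _ he).symm
    _ ≤ (univ.filter fun r => M r j ≠ 0).card := by
        refine Finset.card_le_card fun r hr => ?_
        obtain ⟨x, hx, rfl⟩ := Finset.mem_image.1 hr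
        exact Finset.mem_filter.2 ⟨Finset.mem_univ _, (Finset.mem_filter.1 hx).2⟩

end FullRank

end Literature.InformationTheory.Coding
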